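import Literature.NumberTheory.Sieve.RoughNumbersCoprimeProgressions
import Literature.NumberTheory.Sieve.MoebiusCoprimeProgressions
import Literature.NumberTheory.Sieve.RankinSmoothTail
import Literature.NumberTheory.Sieve.BombieriFriedlanderIwaniecSiegelWalfisz
import Literature.NumberTheory.Sieve.BombieriFriedlanderIwaniecDyadic
import HarnessLib

/-!
# Bombieri–Friedlander–Iwaniec 1986: the Siegel–Walfisz property of the sieved pieces

Trunk `AntSieve`, companion to `Literature.NumberTheory.Sieve.BombieriFriedlanderIwaniecSiegelWalfisz`.
Everything here is PROVED (from the named facts `Literature.NumberTheory.Sieve.SieveSequence.fundamental_lemma_uniform` and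
`Literature.NumberTheory.LFunctions.SiegelWalfiszMoebius`).  After the Heath-Brown identity and the sieving of BFI §15 (p. 244,
(15.1)), the pieces of the coefficient sequences are, on a box `J = (Y₁, Y₂] ⊆ (Nh, 2Nh]`,

* `h(v) = 1_J(v) 1_{(v,P(z))=1}` (from the factors `1`), and
* `h(v) = μ(v) 1_J(v) 1_{(v,P(z))=1}` (from the truncated Möbius factors),

and p. 246 asserts that the resulting convolutions satisfy (A₂) as "a consequence of the
Siegel-Walfisz theorem".  We prove the absolute Siegel–Walfisz property `Literature.NumberTheory.Sieve.BFI.SWAbs` (companion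
file) for both kinds of pieces, uniformly in the box, for sifting levels `z` with
`log z ≤ K (log Nh)^{1/2}` (BFI take `z ≤ exp(log x / log log x)`; "any `z` with `N₀ < z < z₀` would be
equally good", p. 244 — we use `z = exp((log x)^{1/2})` in the assembly):

* `Literature.NumberTheory.Sieve.BFI.swabs_roughBoxOne` — for `1_J 1_{(·,P(z))=1}`, from the fundamental lemma
  (`RoughNumbersCoprimeProgressions.roughCountCop_disc_le`, sieve level `D = Nh^{1/2}`, saving
  `exp(−(log Nh)^{1/2}/(2K))`).
* `Literature.NumberTheory.Sieve.BFI.swabs_roughBoxMoebius` — for `μ 1_J 1_{(·,P(z))=1}`, by Legendre's formula over the divisors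
  `e` of `P(z)`: for `e ≤ Nh^{1/2}` the Möbius sums in progressions with a coprimality condition
  (`MoebiusCoprimeProgressions`), for `e > Nh^{1/2}` Rankin's tail bound (`RankinSmoothTail`).

## References

* E. Bombieri, J. B. Friedlander, H. Iwaniec, Acta Math. 156 (1986), §1 (A₂) p. 206, §15 pp. 244–246.
  [BombieriFriedlanderIwaniecActa1986]
-/

open Finset Real
open scoped ArithmeticFunction.Moebius ArithmeticFunction.sigma

namespace Literature.NumberTheory.Sieve

namespace BFI

/-! ### Two growth lemmas -/

/-- `L^a exp(−b √L) ≤ C(a,b)` for `L ≥ 1` (`b > 0`). [folklore] -/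
theorem exists_rpow_mul_exp_neg_sqrt_le (a : ℝ) {b : ℝ} (hb : 0 < b) :
    ∃ C : ℝ, 0 < C ∧ ∀ L : ℝ, 1 ≤ L → L ^ a * Real.exp (-(b * Real.sqrt L)) ≤ C := by
  rcases le_or_gt a 0 with ha | ha
  · refine ⟨1, one_pos, fun L hL => ?_⟩
    have h1 : L ^ a ≤ 1 := Real.rpow_le_one_of_one_le_of_nonpos hL ha
    have h2 : Real.exp (-(b * Real.sqrt L)) ≤ 1 := by
      rw [Real.exp_le_one_iff]; have := Real.sqrt_nonneg L; nlinarith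
    calc L ^ a * Real.exp (-(b * Real.sqrt L)) ≤ 1 * 1 :=
          mul_le_mul h1 h2 (Real.exp_pos _).le zero_le_one
      _ = 1 := one_mul 1
  · set n : ℕ := ⌈2 * a⌉₊ with hn
    have hn2a : 2 * a ≤ n := Nat.le_ceil _
    refine ⟨(n.factorial : ℝ) / b ^ n + 1, by positivity, fun L hL => ?_⟩
    set u := Real.sqrt L with hu
    have hu1 : 1 ≤ u := by rw [hu]; exact Real.one_le_sqrt.2 hL
    have hu0 : 0 < u := by linarith
    have hLu : L = u ^ (2 : ℝ) := by
      rw [hu, Real.rpow_two, Real.sq_sqrt (by linarith)]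
    -- `L^a = u^{2a} ≤ u^n`
    have h1 : L ^ a ≤ u ^ (n : ℝ) := by
      rw [hLu, ← Real.rpow_mul hu0.le]
      exact Real.rpow_le_rpow_of_exponent_le hu1 hn2a
    -- `exp(bu) ≥ (bu)^n / n!`
    have h2 : (b * u) ^ n / n.factorial ≤ Real.exp (b * u) := Real.pow_div_factorial_le_exp (x := b * u) (by positivity) n
    have hfac : (0 : ℝ) < n.factorial := by exact_mod_cast Nat.factorial_pos n
    have hbu : 0 < (b * u) ^ n := by positivity
    calc L ^ a * Real.exp (-(b * u)) ≤ u ^ (n : ℝ) * Real.exp (-(b * u)) :=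
          mul_le_mul_of_nonneg_right h1 (Real.exp_pos _).le
      _ = u ^ n * (Real.exp (b * u))⁻¹ := by rw [Real.rpow_natCast, Real.exp_neg]
      _ ≤ u ^ n * ((b * u) ^ n / n.factorial)⁻¹ := by
          refine mul_le_mul_of_nonneg_left (inv_anti₀ (by positivity) h2) (by positivity)
      _ = (n.factorial : ℝ) / b ^ n := by
          rw [mul_pow]; field_simp
      _ ≤ (n.factorial : ℝ) / b ^ n + 1 := by linarith

/-- `(log x)^a ≤ C(a,ε) x^ε` for `x ≥ 1` (`a ≥ 0`, `ε > 0`; from `log x ≤ x^δ/δ`).  The case `a > 0` is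
also `Literature.NumberTheory.Sieve.PrimePairMajorArcs.exists_log_rpow_le_rpow` (`CircleMethodMajorArcsPrimePairProofs.lean`), whose
circle-method import closure we do not want here; the eventual form is
`Literature.NumberTheory.Sieve.eventually_log_rpow_le_rpow`. [folklore] -/
theorem exists_log_rpow_le_rpow {a ε : ℝ} (ha : 0 ≤ a) (hε : 0 < ε) :
    ∃ C : ℝ, 0 < C ∧ ∀ x : ℝ, 1 ≤ x → Real.log x ^ a ≤ C * x ^ ε := by
  rcases eq_or_lt_of_le ha with rfl | ha'
  · refine ⟨1, one_pos, fun x hx => ?_⟩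
    rw [Real.rpow_zero, one_mul]
    exact Real.one_le_rpow hx hε.le
  · set δ : ℝ := ε / a with hδ
    have hδ0 : 0 < δ := by positivity
    refine ⟨δ⁻¹ ^ a, by positivity, fun x hx => ?_⟩
    have hx0 : 0 ≤ x := by linarith
    have hlog : 0 ≤ Real.log x := Real.log_nonneg hx
    have h1 : Real.log x ≤ x ^ δ / δ := Real.log_le_rpow_div hx0 hδ0
    calc Real.log x ^ a ≤ (x ^ δ / δ) ^ a := Real.rpow_le_rpow hlog h1 ha
      _ = δ⁻¹ ^ a * (x ^ δ) ^ a := by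
          rw [div_eq_mul_inv, Real.mul_rpow (by positivity) (by positivity), mul_comm]
      _ = δ⁻¹ ^ a * x ^ ε := by
          rw [← Real.rpow_mul hx0]
          congr 2
          rw [hδ]; field_simp

/-! ### Rough numbers: `IsRough` versus coprimality with `P(z)` -/

/-- For `n ≠ 0`: `n` is `z`-rough (`Literature.NumberTheory.Sieve.BFI.IsRough`, every prime factor `≥ z`) iff
`(n, P(z)) = 1`. [folklore] -/
theorem isRough_iff_coprime_primesProdBelow {z : ℝ} {n : ℕ} (hn : n ≠ 0) :
    IsRough z n ↔ n.Coprime (primesProdBelow z) := by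
  rw [coprime_primesProdBelow_iff]
  constructor
  · intro h q hq hqn
    obtain ⟨hqz, hqp⟩ := Nat.mem_primesBelow.1 hq
    have hmem : q ∈ n.primeFactors := Nat.mem_primeFactors.2 ⟨hqp, hqn, hn⟩
    exact (Nat.lt_ceil.1 hqz).not_ge (h q hmem)
  · intro h p hp
    have hpp := Nat.prime_of_mem_primeFactors hp
    have hpn := Nat.dvd_of_mem_primeFactors hp
    by_contra hlt
    rw [not_le] at hlt
    exact h p (Nat.mem_primesBelow.2 ⟨Nat.lt_ceil.2 hlt, hpp⟩) hpn

/-! ### The piece `1_J · 1_{(·,P(z))=1}` -/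

/-- The sieved indicator of the box `J = (Y₁, Y₂]`: `1` if `Y₁ < v ≤ Y₂` and `(v, P(z)) = 1`, else `0`.
[cite: BombieriFriedlanderIwaniecActa1986, §15 (15.1) p. 244] -/
noncomputable def roughBoxOne (z : ℝ) (Y₁ Y₂ : ℕ) : ℕ → ℝ :=
  fun v => if Y₁ < v ∧ v ≤ Y₂ ∧ v.Coprime (primesProdBelow z) then 1 else 0

/-- `|roughBoxOne| ≤ 1`. [folklore] -/
theorem abs_roughBoxOne_le (z : ℝ) (Y₁ Y₂ : ℕ) (v : ℕ) : |roughBoxOne z Y₁ Y₂ v| ≤ 1 := by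
  unfold roughBoxOne; split_ifs <;> simp

/-- The support of `roughBoxOne` lies in `(Y₁, Y₂]`. [folklore] -/
theorem roughBoxOne_eq_zero {z : ℝ} {Y₁ Y₂ v : ℕ} (h : ¬ (Y₁ < v ∧ v ≤ Y₂)) : roughBoxOne z Y₁ Y₂ v = 0 := by
  unfold roughBoxOne
  rw [if_neg]
  tauto

/-- The filtered sums of `roughBoxOne` up to `y` are the counts `roughCountCop` on the segment
`(Y₁, max Y₁ (min Y₂ ⌊y⌋)]`. [folklore] -/
theorem sum_filter_roughBoxOne_eq (z : ℝ) (Y₁ Y₂ : ℕ) (k : ℕ) (l : ZMod k) (d : ℕ) (y : ℝ) :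
    ∑ v ∈ (Icc 1 ⌊y⌋₊).filter (fun v : ℕ => (v : ZMod k) = l ∧ v.Coprime d), roughBoxOne z Y₁ Y₂ v =
      (roughCountCop Y₁ (max Y₁ (min Y₂ ⌊y⌋₊)) k l d z : ℝ) := by
  rw [roughCountCop]
  simp only [roughBoxOne]
  rw [Finset.sum_boole, Finset.filter_filter]
  congr 2
  ext v
  simp only [Finset.mem_filter, Finset.mem_Icc, Finset.mem_Ioc, le_max_iff, le_min_iff]
  constructor
  · rintro ⟨⟨-, hvy⟩, ⟨hl, hd⟩, h1, h2, hP⟩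
    exact ⟨⟨h1, Or.inr ⟨h2, hvy⟩⟩, hl, hd, hP⟩
  · rintro ⟨⟨h1, h | ⟨h2, hvy⟩⟩, hl, hd, hP⟩
    · omega
    · exact ⟨⟨by omega, hvy⟩, ⟨hl, hd⟩, h1, h2, hP⟩

/-- The coprime sums of `roughBoxOne` up to `y` (the main-term side) as `roughCountCop` with modulus `1`.
[folklore] -/
theorem sum_filter_coprime_roughBoxOne_eq (z : ℝ) (Y₁ Y₂ : ℕ) (q : ℕ) (y : ℝ) :
    ∑ v ∈ (Icc 1 ⌊y⌋₊).filter (fun v : ℕ => v.Coprime q), roughBoxOne z Y₁ Y₂ v =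
      (roughCountCop Y₁ (max Y₁ (min Y₂ ⌊y⌋₊)) 1 0 q z : ℝ) := by
  have h := sum_filter_roughBoxOne_eq z Y₁ Y₂ 1 0 q y
  rw [← h]
  refine Finset.sum_congr ?_ fun _ _ => rfl
  ext v
  simp only [Finset.mem_filter, and_congr_right_iff]
  intro _
  constructor
  · intro hq; exact ⟨Subsingleton.elim _ _, hq⟩
  · intro hq; exact hq.2

/-- `τ(k) ≤ k` (real form). [folklore] -/
theorem sigma_zero_le_self_real (k : ℕ) : (σ 0 k : ℝ) ≤ k := by
  rw [ArithmeticFunction.sigma_zero_apply]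
  exact_mod_cast Nat.card_divisors_le_self k

/-- **`SWAbs` for the sieved box indicator** `1_J 1_{(·,P(z))=1}`, `J = (Y₁, Y₂] ⊆ (Nh, 2Nh]`, for
sifting levels `2 ≤ z ≤ Nh^{1/2}` with `log z ≤ K (log Nh)^{1/2}`: for every `A₁, A₂ > 0` there is `C`
(depending on `K, A₁, A₂` and the fundamental-lemma constant only) with
`SWAbs (roughBoxOne z Y₁ Y₂) Nh A₁ A₂ C` whenever `Nh ≥ 3`.  PROVED from the named fact
`Literature.NumberTheory.Sieve.SieveSequence.fundamental_lemma_uniform` via `roughCountCop_disc_le` (level `D = Nh^{1/2}`).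
[cite: BombieriFriedlanderIwaniecActa1986, §15 p. 244–246] -/
theorem swabs_roughBoxOne (hFL : SieveSequence.fundamental_lemma_uniform) {K : ℝ} (hK : 1 ≤ K)
    {A₁ A₂ : ℝ} (hA₁ : 0 < A₁) (hA₂ : 0 < A₂) :
    ∃ C : ℝ, 0 < C ∧ ∀ z Nh : ℝ, ∀ Y₁ Y₂ : ℕ, 2 ≤ z → z ≤ Real.sqrt Nh →
      Real.log z ≤ K * Real.sqrt (Real.log Nh) → 3 ≤ Nh → Nh ≤ Y₁ → (Y₂ : ℝ) ≤ 2 * Nh →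
      SWAbs (roughBoxOne z Y₁ Y₂) Nh A₁ A₂ C := by
  obtain ⟨C₀, hC₀, hdisc⟩ := roughCountCop_disc_le hFL
  have hK0 : 0 < K := by linarith
  obtain ⟨C₁, hC₁, h1⟩ := exists_rpow_mul_exp_neg_sqrt_le (2 * A₁ + A₂) (b := 1 / (2 * K)) (by positivity)
  obtain ⟨C₂, hC₂, h2⟩ := exists_log_rpow_le_rpow (a := 2 * A₁ + A₂) (ε := 1 / 2) (by positivity) (by norm_num)
  refine ⟨2 * (C₀ * C₁ + (C₀ + 2) * C₂), by positivity, ?_⟩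
  intro z Nh Y₁ Y₂ hz hzNh hlogz hNh hY₁ hY₂ k hk hkA l hl d hd y
  haveI : NeZero k := ⟨by omega⟩
  have hNh0 : 0 < Nh := by linarith
  have hlogNh : 1 ≤ Real.log Nh := by
    rw [← Real.log_exp 1]
    refine Real.log_le_log (Real.exp_pos 1) ?_
    have := Real.exp_one_lt_d9; linarith
  have hlogNh0 : 0 < Real.log Nh := by linarith
  have hsqrt : 0 < Real.sqrt Nh := Real.sqrt_pos.2 hNh0
  have hsqrt1 : 1 ≤ Real.sqrt Nh := by rw [Real.one_le_sqrt]; linarith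
  -- the two sums as counts
  rw [sum_filter_roughBoxOne_eq, sum_filter_coprime_roughBoxOne_eq]
  set X₂ := max Y₁ (min Y₂ ⌊y⌋₊) with hX₂
  have hX : Y₁ ≤ X₂ := le_max_left _ _
  have hzD : z ≤ Real.sqrt Nh := hzNh
  have hb := hdisc k hk l hl d hd Y₁ X₂ hX z (Real.sqrt Nh) hz hzD
  refine hb.trans ?_
  -- bound the pieces
  have hτk : (σ 0 k : ℝ) ^ 2 ≤ Real.log Nh ^ (2 * A₁) := by
    calc (σ 0 k : ℝ) ^ 2 ≤ (k : ℝ) ^ 2 := pow_le_pow_left₀ (Nat.cast_nonneg _) (sigma_zero_le_self_real k) 2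
      _ ≤ (Real.log Nh ^ A₁) ^ 2 := by gcongr
      _ = Real.log Nh ^ (2 * A₁) := by rw [← Real.rpow_natCast, ← Real.rpow_mul hlogNh0.le]; ring_nf
  have hX₂Y : (X₂ : ℝ) - Y₁ ≤ Nh := by
    have : (X₂ : ℝ) ≤ max (Y₁ : ℝ) Y₂ := by
      simp only [hX₂]; push_cast
      exact max_le_max le_rfl (by exact_mod_cast min_le_left _ _)
    rcases le_total (Y₁ : ℝ) Y₂ with h12 | h12
    · rw [max_eq_right h12] at this; linarith
    · rw [max_eq_left h12] at this; linarith
  have hk1 : (1 : ℝ) ≤ k := by exact_mod_cast hk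
  have hXk : ((X₂ : ℝ) - Y₁) / k ≤ Nh := (div_le_self (sub_nonneg.2 (by exact_mod_cast hX)) hk1).trans hX₂Y
  -- the saving `exp(-(log √Nh)/(log z)) ≤ exp(-√(log Nh)/(2K))`
  have hlogz0 : 0 < Real.log z := Real.log_pos (by linarith)
  have hexp : Real.exp (-(Real.log (Real.sqrt Nh) / Real.log z)) ≤
      Real.exp (-(1 / (2 * K) * Real.sqrt (Real.log Nh))) := by
    rw [Real.exp_le_exp, neg_le_neg_iff, Real.log_sqrt hNh0.le]
    rw [le_div_iff₀ hlogz0]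
    have hs : Real.sqrt (Real.log Nh) * Real.sqrt (Real.log Nh) = Real.log Nh := Real.mul_self_sqrt hlogNh0.le
    have hs0 : 0 ≤ Real.sqrt (Real.log Nh) := Real.sqrt_nonneg _
    calc 1 / (2 * K) * Real.sqrt (Real.log Nh) * Real.log z
        ≤ 1 / (2 * K) * Real.sqrt (Real.log Nh) * (K * Real.sqrt (Real.log Nh)) :=
          mul_le_mul_of_nonneg_left hlogz (by positivity)
      _ = Real.log Nh / 2 := by field_simp; nlinarith [hs]
  -- Term 1: `(log Nh)^{2A₁} Nh exp(...) ≤ C₁ Nh (log Nh)^{-A₂}`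
  have hT1 : Real.log Nh ^ (2 * A₁) * (C₀ * Nh * Real.exp (-(Real.log (Real.sqrt Nh) / Real.log z))) ≤
      C₀ * C₁ * Nh / Real.log Nh ^ A₂ := by
    have h1' := h1 (Real.log Nh) hlogNh
    rw [le_div_iff₀ (Real.rpow_pos_of_pos hlogNh0 A₂)]
    have hsplit : Real.log Nh ^ (2 * A₁) * Real.log Nh ^ A₂ = Real.log Nh ^ (2 * A₁ + A₂) := by
      rw [← Real.rpow_add hlogNh0]
    calc Real.log Nh ^ (2 * A₁) * (C₀ * Nh * Real.exp (-(Real.log (Real.sqrt Nh) / Real.log z))) * Real.log Nh ^ A₂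
        = C₀ * Nh * ((Real.log Nh ^ (2 * A₁) * Real.log Nh ^ A₂) * Real.exp (-(Real.log (Real.sqrt Nh) / Real.log z))) := by ring
      _ ≤ C₀ * Nh * (Real.log Nh ^ (2 * A₁ + A₂) * Real.exp (-(1 / (2 * K) * Real.sqrt (Real.log Nh)))) := by
          rw [hsplit]
          exact mul_le_mul_of_nonneg_left (mul_le_mul_of_nonneg_left hexp (by positivity)) (by positivity)
      _ ≤ C₀ * Nh * C₁ := mul_le_mul_of_nonneg_left h1' (by positivity)
      _ = C₀ * C₁ * Nh := by ring
  -- Term 2: `(log Nh)^{2A₁} (C₀ + √Nh + 1) ≤ (C₀+2) C₂ Nh (log Nh)^{-A₂}`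
  have hT2 : Real.log Nh ^ (2 * A₁) * (C₀ + Real.sqrt Nh + 1) ≤ (C₀ + 2) * C₂ * Nh / Real.log Nh ^ A₂ := by
    have h2' := h2 Nh (by linarith)
    rw [← Real.sqrt_eq_rpow] at h2'
    rw [le_div_iff₀ (Real.rpow_pos_of_pos hlogNh0 A₂)]
    have hsplit : Real.log Nh ^ (2 * A₁) * Real.log Nh ^ A₂ = Real.log Nh ^ (2 * A₁ + A₂) := by
      rw [← Real.rpow_add hlogNh0]
    have h3 : C₀ + Real.sqrt Nh + 1 ≤ (C₀ + 2) * Real.sqrt Nh := by nlinarith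
    calc Real.log Nh ^ (2 * A₁) * (C₀ + Real.sqrt Nh + 1) * Real.log Nh ^ A₂
        = (Real.log Nh ^ (2 * A₁) * Real.log Nh ^ A₂) * (C₀ + Real.sqrt Nh + 1) := by ring
      _ ≤ (C₂ * Real.sqrt Nh) * ((C₀ + 2) * Real.sqrt Nh) := by
          rw [hsplit]; exact mul_le_mul h2' h3 (by positivity) (by positivity)
      _ = (C₀ + 2) * C₂ * (Real.sqrt Nh * Real.sqrt Nh) := by ring
      _ = (C₀ + 2) * C₂ * Nh := by rw [Real.mul_self_sqrt hNh0.le]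
  -- assemble
  have hτd : (σ 0 d : ℝ) ≤ (σ 0 d : ℝ) ^ 2 := by
    have h1 : (1 : ℝ) ≤ σ 0 d := by exact_mod_cast one_le_sigma_zero hd
    nlinarith
  have hmain : 2 * (σ 0 d : ℝ) * (σ 0 k : ℝ) ^ 2 *
      (C₀ * (((X₂ : ℝ) - Y₁) / k) * Real.exp (-(Real.log (Real.sqrt Nh) / Real.log z)) + C₀ + Real.sqrt Nh + 1) ≤
      2 * (σ 0 d : ℝ) * (Real.log Nh ^ (2 * A₁) *
        (C₀ * Nh * Real.exp (-(Real.log (Real.sqrt Nh) / Real.log z)) + C₀ + Real.sqrt Nh + 1)) := by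
    rw [mul_assoc (2 * (σ 0 d : ℝ)) ((σ 0 k : ℝ) ^ 2)]
    refine mul_le_mul_of_nonneg_left ?_ (by positivity)
    have h0 : C₀ * (((X₂ : ℝ) - Y₁) / k) * Real.exp (-(Real.log (Real.sqrt Nh) / Real.log z)) ≤
        C₀ * Nh * Real.exp (-(Real.log (Real.sqrt Nh) / Real.log z)) :=
      mul_le_mul_of_nonneg_right (mul_le_mul_of_nonneg_left hXk hC₀.le) (Real.exp_pos _).le
    have hle : C₀ * (((X₂ : ℝ) - Y₁) / k) * Real.exp (-(Real.log (Real.sqrt Nh) / Real.log z)) + C₀ + Real.sqrt Nh + 1 ≤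
        C₀ * Nh * Real.exp (-(Real.log (Real.sqrt Nh) / Real.log z)) + C₀ + Real.sqrt Nh + 1 := by linarith
    have hc0 : 0 ≤ C₀ * (((X₂ : ℝ) - Y₁) / k) * Real.exp (-(Real.log (Real.sqrt Nh) / Real.log z)) + C₀ + Real.sqrt Nh + 1 := by
      have : 0 ≤ ((X₂ : ℝ) - Y₁) / k := div_nonneg (sub_nonneg.2 (by exact_mod_cast hX)) (by positivity)
      positivity
    exact mul_le_mul hτk hle hc0 (by positivity)
  refine hmain.trans ?_
  calc 2 * (σ 0 d : ℝ) * (Real.log Nh ^ (2 * A₁) *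
        (C₀ * Nh * Real.exp (-(Real.log (Real.sqrt Nh) / Real.log z)) + C₀ + Real.sqrt Nh + 1))
      = 2 * (σ 0 d : ℝ) * (Real.log Nh ^ (2 * A₁) * (C₀ * Nh * Real.exp (-(Real.log (Real.sqrt Nh) / Real.log z))) +
          Real.log Nh ^ (2 * A₁) * (C₀ + Real.sqrt Nh + 1)) := by ring
    _ ≤ 2 * (σ 0 d : ℝ) * (C₀ * C₁ * Nh / Real.log Nh ^ A₂ + (C₀ + 2) * C₂ * Nh / Real.log Nh ^ A₂) :=
        mul_le_mul_of_nonneg_left (add_le_add hT1 hT2) (by positivity)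
    _ = 2 * (C₀ * C₁ + (C₀ + 2) * C₂) * (σ 0 d : ℝ) * Nh / Real.log Nh ^ A₂ := by ring
    _ ≤ 2 * (C₀ * C₁ + (C₀ + 2) * C₂) * (σ 0 d : ℝ) ^ 2 * Nh / Real.log Nh ^ A₂ := by
        refine div_le_div_of_nonneg_right ?_ (by positivity)
        refine mul_le_mul_of_nonneg_right (mul_le_mul_of_nonneg_left hτd (by positivity)) hNh0.le

/-! ### The piece `μ · 1_J · 1_{(·,P(z))=1}` -/

/-- The sieved, boxed Möbius function: `μ(v)` if `Y₁ < v ≤ Y₂` and `(v, P(z)) = 1`, else `0`.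
[cite: BombieriFriedlanderIwaniecActa1986, §15 p. 244–246] -/
noncomputable def roughBoxMoebius (z : ℝ) (Y₁ Y₂ : ℕ) : ℕ → ℝ :=
  fun v => if Y₁ < v ∧ v ≤ Y₂ ∧ v.Coprime (primesProdBelow z) then (μ v : ℝ) else 0

/-- `|roughBoxMoebius| ≤ 1`. [folklore] -/
theorem abs_roughBoxMoebius_le (z : ℝ) (Y₁ Y₂ : ℕ) (v : ℕ) : |roughBoxMoebius z Y₁ Y₂ v| ≤ 1 := by
  unfold roughBoxMoebius
  split_ifs
  · exact_mod_cast ArithmeticFunction.abs_moebius_le_one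
  · simp

/-- The support of `roughBoxMoebius` lies in `(Y₁, Y₂]`. [folklore] -/
theorem roughBoxMoebius_eq_zero {z : ℝ} {Y₁ Y₂ v : ℕ} (h : ¬ (Y₁ < v ∧ v ≤ Y₂)) :
    roughBoxMoebius z Y₁ Y₂ v = 0 := by
  unfold roughBoxMoebius
  rw [if_neg]
  tauto

/-- `μ(ew) = μ(e) μ(w)` if `(e, w) = 1` and `μ(ew) = 0` otherwise (then `ew` is not squarefree).
[folklore] -/
theorem moebius_mul_eq (e w : ℕ) :
    (μ (e * w) : ℝ) = if e.Coprime w then (μ e : ℝ) * μ w else 0 := by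
  split_ifs with h
  · rw [ArithmeticFunction.isMultiplicative_moebius.map_mul_of_coprime h]; push_cast; ring
  · rw [ArithmeticFunction.moebius_eq_zero_of_not_squarefree]
    · simp
    · intro hsq
      apply h
      rw [Nat.coprime_iff_gcd_eq_one]
      by_contra hg
      obtain ⟨p, hp, hpg⟩ := Nat.exists_prime_and_dvd hg
      have hpe : p ∣ e := hpg.trans (Nat.gcd_dvd_left e w)
      have hpw : p ∣ w := hpg.trans (Nat.gcd_dvd_right e w)
      have hpp : p * p ∣ e * w := Nat.mul_dvd_mul hpe hpw
      exact hp.not_isUnit (hsq p hpp)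

/-- Dividing out a factor in a sum: for `t ≥ 1`,
`∑_{X₁ < m ≤ X₂, t ∣ m} F(m) = ∑_{X₁/t < m' ≤ X₂/t} F(t m')`. [folklore] -/
theorem sum_Ioc_filter_dvd_eq {t : ℕ} (ht : 0 < t) (X₁ X₂ : ℕ) (F : ℕ → ℝ) :
    ∑ m ∈ (Ioc X₁ X₂).filter (fun m : ℕ => t ∣ m), F m = ∑ m' ∈ Ioc (X₁ / t) (X₂ / t), F (t * m') := by
  refine Finset.sum_bij' (fun m _ => m / t) (fun m' _ => t * m') ?_ ?_ ?_ ?_ ?_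
  · intro m hm
    rw [Finset.mem_filter, Finset.mem_Ioc] at hm
    obtain ⟨⟨h1, h2⟩, ⟨q, rfl⟩⟩ := hm
    rw [Finset.mem_Ioc, Nat.mul_div_cancel_left q ht]
    refine ⟨?_, ?_⟩
    · rw [Nat.div_lt_iff_lt_mul ht]; rw [mul_comm] at h1; exact h1
    · rw [Nat.le_div_iff_mul_le ht]; rw [mul_comm] at h2; exact h2
  · intro m' hm'
    rw [Finset.mem_Ioc] at hm'
    obtain ⟨h1, h2⟩ := hm'
    rw [Finset.mem_filter, Finset.mem_Ioc]
    refine ⟨⟨?_, ?_⟩, ⟨m', rfl⟩⟩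
    · rw [Nat.div_lt_iff_lt_mul ht] at h1; rw [mul_comm]; exact h1
    · rw [Nat.le_div_iff_mul_le ht] at h2; rw [mul_comm]; exact h2
  · intro m hm
    rw [Finset.mem_filter] at hm
    obtain ⟨-, ⟨q, rfl⟩⟩ := hm
    rw [Nat.mul_div_cancel_left q ht]
  · intro m' _
    exact Nat.mul_div_cancel_left m' ht
  · intro m hm
    rw [Finset.mem_filter] at hm
    obtain ⟨-, ⟨q, rfl⟩⟩ := hm
    rw [Nat.mul_div_cancel_left q ht]

/-- Splitting a filtered sum over `(A, B]` as a difference of two prefix sums over `[1, B]` and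
`[1, A]` (`A ≤ B`). [folklore] -/
theorem sum_Ioc_filter_eq_sub {A B : ℕ} (hAB : A ≤ B) (P : ℕ → Prop) [DecidablePred P] (F : ℕ → ℝ) :
    ∑ m ∈ (Ioc A B).filter P, F m =
      (∑ m ∈ (Icc 1 B).filter P, F m) - ∑ m ∈ (Icc 1 A).filter P, F m := by
  have h1 : Icc 1 B = Ioc 0 B := by ext x; simp only [Finset.mem_Icc, Finset.mem_Ioc]; omega
  have h2 : Icc 1 A = Ioc 0 A := by ext x; simp only [Finset.mem_Icc, Finset.mem_Ioc]; omega
  rw [h1, h2, Finset.sum_filter, Finset.sum_filter, Finset.sum_filter,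
    ← Finset.sum_Ioc_consecutive _ (Nat.zero_le A) hAB]
  ring

/-- The filtered sums of `roughBoxMoebius` up to `y` as sums of `μ` over the filtered segment
`(Y₁, max Y₁ (min Y₂ ⌊y⌋)]`. [folklore] -/
theorem sum_filter_roughBoxMoebius_eq (z : ℝ) (Y₁ Y₂ : ℕ) (P : ℕ → Prop) [DecidablePred P] (y : ℝ) :
    ∑ v ∈ (Icc 1 ⌊y⌋₊).filter P, roughBoxMoebius z Y₁ Y₂ v =
      ∑ v ∈ (Ioc Y₁ (max Y₁ (min Y₂ ⌊y⌋₊))).filter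
        (fun v : ℕ => P v ∧ v.Coprime (primesProdBelow z)), (μ v : ℝ) := by
  unfold roughBoxMoebius
  rw [← Finset.sum_filter, Finset.filter_filter]
  refine Finset.sum_congr ?_ fun _ _ => rfl
  ext v
  simp only [Finset.mem_filter, Finset.mem_Icc, Finset.mem_Ioc, le_max_iff, le_min_iff]
  constructor
  · rintro ⟨⟨-, hvy⟩, hP, h1, h2, hP'⟩
    exact ⟨⟨h1, Or.inr ⟨h2, hvy⟩⟩, hP, hP'⟩
  · rintro ⟨⟨h1, h | ⟨h2, hvy⟩⟩, hP, hP'⟩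
    · omega
    · exact ⟨⟨by omega, hvy⟩, hP, h1, h2, hP'⟩

/-- `ω(mn) ≤ ω(m) + ω(n)`, hence `4^{ω(mn)} ≤ 4^{ω(m)} 4^{ω(n)}`. [folklore] -/
theorem four_pow_card_primeFactors_mul_le (m n : ℕ) :
    (4 : ℝ) ^ (m * n).primeFactors.card ≤ (4 : ℝ) ^ m.primeFactors.card * (4 : ℝ) ^ n.primeFactors.card := by
  rw [← pow_add]
  refine pow_le_pow_right₀ (by norm_num) ?_
  rcases eq_or_ne m 0 with rfl | hm
  · simp
  rcases eq_or_ne n 0 with rfl | hn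
  · simp
  rw [Nat.primeFactors_mul hm hn]
  exact Finset.card_union_le _ _

set_option maxHeartbeats 3200000 in
/-- **The sieved, boxed Möbius sums in progressions with a coprimality condition are small.**
For `K ≥ 1`, `A₁ > 0`, `B ≥ 0` there is `C > 0` such that for all `z ≥ 8` with
`log z ≤ K (log Nh)^{1/2}`, `Nh ≥ e^{16}`, boxes `(Y₁, Y₂] ⊆ (Nh, 2Nh]` (`Nh ≤ Y₁ ≤ Y₂ ≤ 2Nh`), moduli
`1 ≤ k' ≤ (log Nh)^{A₁}`, reduced classes `a`, all `q ≥ 1` and all `y`: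
`|∑_{v ≤ y, v ≡ a (k'), (v,q)=1} μ(v) 1_J(v) 1_{(v,P(z))=1}| ≤ C 4^{ω(q)} Nh (log Nh)^{−B}`.
PROVED: Legendre's formula in `P(z)`, then for `e ≤ Nh^{1/2}` the Möbius sums with coprimality
condition `(·, qe) = 1` (`SiegelWalfiszMoebius.sum_coprime_progression_le`) and `∑_e 4^{ω(e)}/e ≪ log⁸`,
for `e > Nh^{1/2}` the trivial bound and Rankin's tail (`sum_inv_smoothNumbersUpTo_tail_le_log`).
[cite: BombieriFriedlanderIwaniecActa1986, §15 p. 246] -/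
theorem abs_sum_roughBoxMoebius_le (hSW : LFunctions.SiegelWalfiszMoebius) {K : ℝ} (hK : 1 ≤ K)
    {A₁ B : ℝ} (hA₁ : 0 < A₁) (hB : 0 ≤ B) :
    ∃ C : ℝ, 0 < C ∧ ∀ z Nh : ℝ, ∀ Y₁ Y₂ : ℕ, 8 ≤ z → Real.log z ≤ K * Real.sqrt (Real.log Nh) →
      Real.exp 16 ≤ Nh → Nh ≤ Y₁ → Y₁ ≤ Y₂ → (Y₂ : ℝ) ≤ 2 * Nh →
      ∀ k' : ℕ, 1 ≤ k' → (k' : ℝ) ≤ Real.log Nh ^ A₁ → ∀ a : ZMod k', IsUnit a →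
      ∀ q : ℕ, q ≠ 0 → ∀ y : ℝ,
        |∑ v ∈ (Icc 1 ⌊y⌋₊).filter (fun v : ℕ => (v : ZMod k') = a ∧ v.Coprime q),
            roughBoxMoebius z Y₁ Y₂ v| ≤ C * (4 : ℝ) ^ q.primeFactors.card * Nh / Real.log Nh ^ B := by
  have hK0 : 0 < K := by linarith
  -- constants
  obtain ⟨Cc, hCc0, hc⟩ := hSW.sum_coprime_progression_le (A := 2 * A₁) (by positivity) (B := B + 8) (by linarith)
  obtain ⟨C₂, hC₂, h2⟩ := exists_sum_sigma_zero_pow_div_le_real 2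
  obtain ⟨C₁, hC₁, h1⟩ := exists_rpow_mul_exp_neg_sqrt_le (31 / 2 + (B + 8)) (b := 1 / (4 * K)) (by positivity)
  have hlog2 : 0 < Real.log 2 := Real.log_pos one_lt_two
  set CR : ℝ := (Real.exp 5 / Real.log 2) * (Real.exp 6 / Real.log 2) ^ 30 with hCR
  have hCR0 : 0 < CR := by simp only [hCR]; positivity
  set Chead : ℝ := 4 * Cc * (4 : ℝ) ^ (B + 8) * C₂ with hChead
  set Ctail : ℝ := 3 * CR * (2 * K) ^ (31 : ℕ) * C₁ with hCtail
  have hChead0 : 0 ≤ Chead := by simp only [hChead]; positivity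
  have hCtail0 : 0 ≤ Ctail := by simp only [hCtail]; positivity
  refine ⟨Chead + Ctail + 1, by positivity, ?_⟩
  intro z Nh Y₁ Y₂ hz hlogz hNh hY₁ hY hY₂ k' hk' hk'A a ha q hq y
  haveI : NeZero k' := ⟨by omega⟩
  -- basic sizes
  have hNh16 : (16 : ℝ) ≤ Real.log Nh := by
    rw [← Real.log_exp 16]; exact Real.log_le_log (Real.exp_pos _) hNh
  have he16 : (2 : ℝ) ^ 16 ≤ Real.exp 16 := by
    have h := Real.add_one_le_exp (1 : ℝ)
    have h2 : (2 : ℝ) ≤ Real.exp 1 := by linarith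
    calc (2 : ℝ) ^ 16 ≤ (Real.exp 1) ^ 16 := pow_le_pow_left₀ (by norm_num) h2 16
      _ = Real.exp 16 := by rw [← Real.exp_nat_mul]; norm_num
  have hNhbig : (2 : ℝ) ^ 16 ≤ Nh := he16.trans hNh
  have hNh0 : 0 < Nh := lt_of_lt_of_le (by positivity) hNhbig
  have hlogNh0 : 0 < Real.log Nh := by linarith
  have hlogNh1 : 1 ≤ Real.log Nh := by linarith
  set L := Real.log Nh with hL
  set R := Real.sqrt Nh with hR
  have hR0 : 0 < R := Real.sqrt_pos.2 hNh0
  have hRR : R * R = Nh := Real.mul_self_sqrt hNh0.le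
  have hR256 : (256 : ℝ) ≤ R := by
    have : Real.sqrt ((2 : ℝ) ^ 16) = 256 := by
      rw [show ((2 : ℝ) ^ 16) = 256 ^ 2 by norm_num, Real.sqrt_sq (by norm_num)]
    rw [← this]; exact Real.sqrt_le_sqrt hNhbig
  have hlogR : Real.log R = L / 2 := by rw [hR, Real.log_sqrt hNh0.le]
  have hz0 : 0 < z := by linarith
  have hlogz0 : 0 < Real.log z := Real.log_pos (by linarith)
  set P := primesProdBelow z with hP
  have hP0 : P ≠ 0 := primesProdBelow_ne_zero z
  have hsqL : Real.sqrt L * Real.sqrt L = L := Real.mul_self_sqrt hlogNh0.le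
  have hsqL0 : 0 < Real.sqrt L := Real.sqrt_pos.2 hlogNh0
  -- the segment
  set X₂ := max Y₁ (min Y₂ ⌊y⌋₊) with hX₂
  have hX : Y₁ ≤ X₂ := le_max_left _ _
  have hX₂Y₂ : X₂ ≤ Y₂ := max_le hY (min_le_left _ _)
  have hX₂le : (X₂ : ℝ) ≤ 2 * Nh := le_trans (by exact_mod_cast hX₂Y₂) hY₂
  have hY₁R : (Y₁ : ℝ) ≥ R * R := by rw [hRR]; exact hY₁
  -- Step 0: the sum as a Möbius sum over the sieved, filtered segment
  rw [sum_filter_roughBoxMoebius_eq]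
  set Cnd : ℕ → Prop := fun v => (v : ZMod k') = a ∧ v.Coprime q with hCnd
  -- Step 1: Legendre
  have hLeg : ∑ v ∈ (Ioc Y₁ X₂).filter (fun v : ℕ => Cnd v ∧ v.Coprime P), (μ v : ℝ) =
      ∑ e ∈ P.divisors, ∑ v ∈ (Ioc Y₁ X₂).filter (fun v : ℕ => e ∣ v),
        (if Cnd v then (μ e : ℝ) * μ v else 0) := by
    calc ∑ v ∈ (Ioc Y₁ X₂).filter (fun v : ℕ => Cnd v ∧ v.Coprime P), (μ v : ℝ)
        = ∑ v ∈ (Ioc Y₁ X₂).filter Cnd, (if v.Coprime P then (1 : ℝ) else 0) * μ v := by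
          rw [← Finset.filter_filter, Finset.sum_filter (p := fun v : ℕ => v.Coprime P)]
          refine Finset.sum_congr rfl fun v _ => ?_
          split_ifs <;> simp
      _ = ∑ v ∈ (Ioc Y₁ X₂).filter Cnd, ∑ e ∈ P.divisors, (if e ∣ v then (μ e : ℝ) * μ v else 0) := by
          refine Finset.sum_congr rfl fun v hv => ?_
          have hv0 : v ≠ 0 := by
            have := (Finset.mem_Ioc.1 (Finset.mem_filter.1 hv).1).1; omega
          rw [coprime_indicator_eq_sum_moebius hv0 hP0, Finset.sum_filter, Finset.sum_mul]
          refine Finset.sum_congr rfl fun e _ => ?_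
          split_ifs <;> simp
      _ = ∑ e ∈ P.divisors, ∑ v ∈ (Ioc Y₁ X₂).filter Cnd, (if e ∣ v then (μ e : ℝ) * μ v else 0) :=
          Finset.sum_comm
      _ = ∑ e ∈ P.divisors, ∑ v ∈ (Ioc Y₁ X₂).filter (fun v : ℕ => e ∣ v),
            (if Cnd v then (μ e : ℝ) * μ v else 0) := by
          refine Finset.sum_congr rfl fun e _ => ?_
          rw [Finset.sum_filter, Finset.sum_filter]
          refine Finset.sum_congr rfl fun v _ => ?_
          split_ifs <;> rfl
  rw [hLeg]
  -- Step 2: each inner sum is a filtered Möbius sum `J e` over the divided segment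
  set J : ℕ → ℝ := fun e => ∑ w ∈ (Ioc (Y₁ / e) (X₂ / e)).filter
      (fun w : ℕ => Cnd (e * w) ∧ e.Coprime w), (μ w : ℝ) with hJ
  have hinner : ∀ e ∈ P.divisors,
      ∑ v ∈ (Ioc Y₁ X₂).filter (fun v : ℕ => e ∣ v), (if Cnd v then (μ e : ℝ) * μ v else 0) = J e := by
    intro e he
    have he0 : 0 < e := Nat.pos_of_mem_divisors he
    have hesq : Squarefree e := (squarefree_primesProdBelow z).squarefree_of_dvd (Nat.dvd_of_mem_divisors he)
    have hμe : (μ e : ℝ) * (μ e : ℝ) = 1 := by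
      have := ArithmeticFunction.moebius_sq_eq_one_of_squarefree hesq
      rw [← sq]; exact_mod_cast this
    rw [sum_Ioc_filter_dvd_eq he0 Y₁ X₂ (fun v => if Cnd v then (μ e : ℝ) * μ v else 0)]
    simp only [hJ]
    rw [Finset.sum_filter]
    refine Finset.sum_congr rfl fun w _ => ?_
    rw [moebius_mul_eq e w]
    by_cases h1 : Cnd (e * w) <;> by_cases h2 : e.Coprime w <;> simp [h1, h2]
    rw [← mul_assoc, hμe, one_mul]
  rw [Finset.sum_congr rfl hinner]
  -- Step 3: bounds for `J e`
  -- (a) the unit / coprime reduction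
  have hJform : ∀ e : ℕ, 0 < e → e.Coprime q → ∀ u : (ZMod k')ˣ, (u : ZMod k') = e →
      J e = (∑ w ∈ (Icc 1 (X₂ / e)).filter (fun w : ℕ => (w : ZMod k') = ↑u⁻¹ * a ∧ w.Coprime (q * e)), (μ w : ℝ)) -
        ∑ w ∈ (Icc 1 (Y₁ / e)).filter (fun w : ℕ => (w : ZMod k') = ↑u⁻¹ * a ∧ w.Coprime (q * e)), (μ w : ℝ) := by
    intro e he0 heq u hu
    simp only [hJ]
    rw [← sum_Ioc_filter_eq_sub (Nat.div_le_div_right hX)]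
    refine Finset.sum_congr ?_ fun _ _ => rfl
    refine Finset.filter_congr fun w _ => ?_
    simp only [hCnd]
    have hiff1 : (((e * w : ℕ) : ZMod k') = a) ↔ ((w : ZMod k') = ↑u⁻¹ * a) := by
      push_cast
      rw [← hu]
      constructor
      · intro h1; rw [← h1, ← mul_assoc, Units.inv_mul, one_mul]
      · intro h1; rw [h1, ← mul_assoc, Units.mul_inv, one_mul]
    rw [hiff1, Nat.coprime_mul_iff_right, Nat.coprime_comm (m := e)]
    constructor
    · rintro ⟨⟨h1, h2⟩, h3⟩; exact ⟨h1, Nat.Coprime.coprime_mul_left h2, h3⟩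
    · rintro ⟨h1, h2, h3⟩; exact ⟨⟨h1, Nat.Coprime.mul_left heq h2⟩, h3⟩
  -- (b) when `e` is not a unit mod `k'` or not coprime to `q`, `J e = 0`
  have hJzero : ∀ e : ℕ, (¬ IsUnit (e : ZMod k') ∨ ¬ e.Coprime q) → J e = 0 := by
    intro e hbad
    simp only [hJ]
    refine Finset.sum_eq_zero fun w hw => ?_
    exfalso
    obtain ⟨-, ⟨⟨h1, h2⟩, -⟩⟩ := Finset.mem_filter.1 hw
    rcases hbad with hu | hcq
    · apply hu
      push_cast at h1
      rw [← h1] at ha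
      exact isUnit_of_mul_isUnit_left ha
    · exact hcq (Nat.Coprime.coprime_mul_right h2)
  -- (c) sizes of the divided segment for `e ≤ R`
  have hdivlow : ∀ e : ℕ, 0 < e → (e : ℝ) ≤ R → ∀ X : ℕ, Y₁ / e ≤ X → (R / 2 : ℝ) ≤ X := by
    intro e he0 heR X hX1
    have he0' : (0 : ℝ) < e := by exact_mod_cast he0
    have h1 : ((Y₁ / e : ℕ) : ℝ) ≥ (Y₁ : ℝ) / e - 1 := by
      have := Nat.lt_div_mul_add he0 (a := Y₁)
      have h' : (Y₁ : ℝ) < ((Y₁ / e : ℕ) : ℝ) * e + e := by exact_mod_cast this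
      rw [ge_iff_le, sub_le_iff_le_add, div_le_iff₀ he0']
      linarith
    have h2 : (R : ℝ) ≤ (Y₁ : ℝ) / e := by
      rw [le_div_iff₀ he0']
      calc R * e ≤ R * R := mul_le_mul_of_nonneg_left heR hR0.le
        _ ≤ Y₁ := hY₁R
    have h3 : ((Y₁ / e : ℕ) : ℝ) ≤ X := by exact_mod_cast hX1
    linarith
  have hlogX : ∀ X : ℕ, (R / 2 : ℝ) ≤ X → L / 4 ≤ Real.log X ∧ (2 : ℝ) ≤ X := by
    intro X hX
    have hX2 : (2 : ℝ) ≤ X := by linarith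
    refine ⟨?_, hX2⟩
    have hlog2' : Real.log 2 ≤ L / 4 := by
      have : Real.log 2 ≤ 1 := by have := Real.log_two_lt_d9; linarith
      linarith
    calc L / 4 = L / 2 - L / 4 := by ring
      _ ≤ Real.log R - Real.log 2 := by rw [hlogR]; linarith
      _ = Real.log (R / 2) := by rw [Real.log_div hR0.ne' two_ne_zero]
      _ ≤ Real.log X := Real.log_le_log (by positivity) hX
  have hkX : ∀ X : ℕ, (R / 2 : ℝ) ≤ X → (k' : ℝ) ≤ Real.log X ^ (2 * A₁) := by
    intro X hX
    obtain ⟨hlX, -⟩ := hlogX X hX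
    calc (k' : ℝ) ≤ L ^ A₁ := hk'A
      _ ≤ (L / 4) ^ (2 * A₁) := by
          rw [Real.rpow_mul (by positivity)]
          refine Real.rpow_le_rpow hlogNh0.le ?_ hA₁.le
          rw [Real.rpow_two]; nlinarith
      _ ≤ Real.log X ^ (2 * A₁) := Real.rpow_le_rpow (by positivity) hlX (by positivity)
  -- (d) the head bound for `J e`, `e ≤ R`
  have hhead : ∀ e ∈ P.divisors, (e : ℝ) ≤ R →
      |J e| ≤ 2 * (Cc * (4 : ℝ) ^ q.primeFactors.card * (4 : ℝ) ^ (B + 8) * (2 * Nh) / L ^ (B + 8)) *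
        ((4 : ℝ) ^ e.primeFactors.card / e) := by
    intro e he heR
    have he0 : 0 < e := Nat.pos_of_mem_divisors he
    have he0' : (0 : ℝ) < e := by exact_mod_cast he0
    by_cases hgood : IsUnit (e : ZMod k') ∧ e.Coprime q
    swap
    · rw [hJzero e (not_and_or.1 hgood), abs_zero]; positivity
    obtain ⟨⟨u, hu⟩, heq⟩ := hgood
    rw [hJform e he0 heq u hu]
    -- each prefix sum
    have hpre : ∀ X : ℕ, Y₁ / e ≤ X → X ≤ X₂ / e →
        |∑ w ∈ (Icc 1 X).filter (fun w : ℕ => (w : ZMod k') = ↑u⁻¹ * a ∧ w.Coprime (q * e)), (μ w : ℝ)| ≤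
          Cc * (4 : ℝ) ^ q.primeFactors.card * (4 : ℝ) ^ (B + 8) * (2 * Nh) / L ^ (B + 8) *
            ((4 : ℝ) ^ e.primeFactors.card / e) := by
      intro X hX1 hX2
      have hRX := hdivlow e he0 heR X hX1
      obtain ⟨hlX, hX2'⟩ := hlogX X hRX
      have hX0 : (0 : ℝ) < X := by linarith
      have h := hc X hX2' k' hk' (hkX X hRX) (↑u⁻¹ * a) ((Units.isUnit _).mul ha) (q * e)
        (mul_ne_zero hq he0.ne')
      rw [Nat.floor_natCast] at h
      refine h.trans ?_
      -- `X ≤ 2Nh/e`, `4^{ω(qe)} ≤ 4^{ω q} 4^{ω e}`, `(log X)^{-(B+8)} ≤ (L/4)^{-(B+8)}`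
      have hXle : (X : ℝ) ≤ 2 * Nh / e := by
        rw [le_div_iff₀ he0']
        have h1 : (X : ℝ) * e ≤ X₂ := by
          have := Nat.div_mul_le_self X₂ e
          calc (X : ℝ) * e ≤ ((X₂ / e : ℕ) : ℝ) * e :=
                mul_le_mul_of_nonneg_right (by exact_mod_cast hX2) he0'.le
            _ ≤ X₂ := by exact_mod_cast this
        linarith
      have hω := four_pow_card_primeFactors_mul_le q e
      have hlogpow : (Real.log X ^ (B + 8))⁻¹ ≤ (4 : ℝ) ^ (B + 8) * (L ^ (B + 8))⁻¹ := by
        have h1 : (L / 4) ^ (B + 8) ≤ Real.log X ^ (B + 8) := Real.rpow_le_rpow (by positivity) hlX (by linarith)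
        rw [Real.div_rpow hlogNh0.le (by norm_num)] at h1
        have h2 := inv_anti₀ (by positivity) h1
        rw [inv_div, div_eq_mul_inv] at h2
        exact h2
      rw [div_eq_mul_inv, div_eq_mul_inv, div_eq_mul_inv]
      calc Cc * (4 : ℝ) ^ (q * e).primeFactors.card * X * (Real.log X ^ (B + 8))⁻¹
          ≤ Cc * ((4 : ℝ) ^ q.primeFactors.card * (4 : ℝ) ^ e.primeFactors.card) * (2 * Nh / e) *
              ((4 : ℝ) ^ (B + 8) * (L ^ (B + 8))⁻¹) := by
            refine mul_le_mul (mul_le_mul (mul_le_mul_of_nonneg_left hω hCc0) hXle (by positivity)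
              (by positivity)) hlogpow (by positivity) (by positivity)
        _ = Cc * (4 : ℝ) ^ q.primeFactors.card * (4 : ℝ) ^ (B + 8) * (2 * Nh) * (L ^ (B + 8))⁻¹ *
              ((4 : ℝ) ^ e.primeFactors.card * (e : ℝ)⁻¹) := by
            rw [div_eq_mul_inv]; ring
    have hA := hpre (X₂ / e) (Nat.div_le_div_right hX) le_rfl
    have hB' := hpre (Y₁ / e) le_rfl (Nat.div_le_div_right hX)
    calc _ ≤ |∑ w ∈ (Icc 1 (X₂ / e)).filter (fun w : ℕ => (w : ZMod k') = ↑u⁻¹ * a ∧ w.Coprime (q * e)), (μ w : ℝ)| +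
          |∑ w ∈ (Icc 1 (Y₁ / e)).filter (fun w : ℕ => (w : ZMod k') = ↑u⁻¹ * a ∧ w.Coprime (q * e)), (μ w : ℝ)| :=
          abs_sub _ _
      _ ≤ _ := by linarith
  -- (e) the tail bound for `J e`, `e > R`
  have htail : ∀ e ∈ P.divisors, R < (e : ℝ) → |J e| ≤ 3 * Nh / e := by
    intro e he hRe
    have he0 : 0 < e := Nat.pos_of_mem_divisors he
    have he0' : (0 : ℝ) < e := by exact_mod_cast he0
    by_cases h2 : (e : ℝ) ≤ 2 * Nh
    · have hcard : |J e| ≤ ((X₂ / e : ℕ) : ℝ) - ((Y₁ / e : ℕ) : ℝ) := by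
        simp only [hJ]
        calc |∑ w ∈ (Ioc (Y₁ / e) (X₂ / e)).filter (fun w : ℕ => Cnd (e * w) ∧ e.Coprime w), (μ w : ℝ)|
            ≤ ∑ w ∈ (Ioc (Y₁ / e) (X₂ / e)).filter (fun w : ℕ => Cnd (e * w) ∧ e.Coprime w), |(μ w : ℝ)| :=
              Finset.abs_sum_le_sum_abs _ _
          _ ≤ ∑ w ∈ (Ioc (Y₁ / e) (X₂ / e)).filter (fun w : ℕ => Cnd (e * w) ∧ e.Coprime w), (1 : ℝ) :=
              Finset.sum_le_sum fun w _ => by exact_mod_cast ArithmeticFunction.abs_moebius_le_one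
          _ ≤ ∑ w ∈ Ioc (Y₁ / e) (X₂ / e), (1 : ℝ) :=
              Finset.sum_le_sum_of_subset_of_nonneg (Finset.filter_subset _ _) fun _ _ _ => zero_le_one
          _ = ((X₂ / e : ℕ) : ℝ) - ((Y₁ / e : ℕ) : ℝ) := by
              rw [Finset.sum_const, nsmul_eq_mul, mul_one, Nat.card_Ioc, Nat.cast_sub (Nat.div_le_div_right hX)]
      have hdiff := abs_natDiv_sub_natDiv_sub_le he0 Y₁ X₂
      have hX₂Y₁ : (X₂ : ℝ) - Y₁ ≤ Nh := by
        have : (Y₁ : ℝ) ≥ Nh := hY₁; linarith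
      have h1 : 1 ≤ 2 * Nh / e := by rw [le_div_iff₀ he0']; linarith
      calc |J e| ≤ ((X₂ / e : ℕ) : ℝ) - ((Y₁ / e : ℕ) : ℝ) := hcard
        _ ≤ ((X₂ : ℝ) - Y₁) / e + 1 := by linarith [(abs_le.1 hdiff).2]
        _ ≤ Nh / e + 1 := by gcongr
        _ ≤ Nh / e + 2 * Nh / e := by linarith
        _ = 3 * Nh / e := by ring
    · -- `e > 2Nh`: the divided segment is empty
      rw [not_le] at h2
      have hX₂e : X₂ / e = 0 := Nat.div_eq_of_lt (by exact_mod_cast (hX₂le.trans_lt h2))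
      have hJ0 : J e = 0 := by
        simp only [hJ]
        refine Finset.sum_eq_zero fun w hw => ?_
        exfalso
        have h3 := (Finset.mem_Ioc.1 (Finset.mem_filter.1 hw).1).2
        have h4 := (Finset.mem_Ioc.1 (Finset.mem_filter.1 hw).1).1
        have h5 : w = 0 := Nat.le_zero.1 (hX₂e ▸ h3)
        rw [h5] at h4
        exact Nat.not_lt_zero _ h4
      rw [hJ0, abs_zero]; positivity
  have hJbig : ∀ e ∈ P.divisors, 2 * Nh < (e : ℝ) → J e = 0 := by
    intro e he h2
    have hX₂e : X₂ / e = 0 := Nat.div_eq_of_lt (by exact_mod_cast (hX₂le.trans_lt h2))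
    simp only [hJ]
    refine Finset.sum_eq_zero fun w hw => ?_
    exfalso
    have h3 := (Finset.mem_Ioc.1 (Finset.mem_filter.1 hw).1).2
    have h4 := (Finset.mem_Ioc.1 (Finset.mem_filter.1 hw).1).1
    have h5 : w = 0 := Nat.le_zero.1 (hX₂e ▸ h3)
    rw [h5] at h4
    exact Nat.not_lt_zero _ h4
  -- Step 4: the head sum
  set Hc : ℝ := Cc * (4 : ℝ) ^ q.primeFactors.card * (4 : ℝ) ^ (B + 8) * (2 * Nh) / L ^ (B + 8) with hHc
  have hHc0 : 0 ≤ Hc := by simp only [hHc]; positivity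
  have hR2 : (2 : ℝ) ≤ R := by linarith
  have hheadsum : ∑ e ∈ P.divisors.filter (fun e : ℕ => (e : ℝ) ≤ R), |J e| ≤
      Chead * (4 : ℝ) ^ q.primeFactors.card * Nh / L ^ B := by
    have hdiv : ∑ e ∈ P.divisors.filter (fun e : ℕ => (e : ℝ) ≤ R), (4 : ℝ) ^ e.primeFactors.card / e ≤
        C₂ * L ^ (8 : ℕ) := by
      calc ∑ e ∈ P.divisors.filter (fun e : ℕ => (e : ℝ) ≤ R), (4 : ℝ) ^ e.primeFactors.card / e
          ≤ ∑ e ∈ P.divisors.filter (fun e : ℕ => (e : ℝ) ≤ R), (σ 0 e : ℝ) ^ 2 / e := by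
            refine Finset.sum_le_sum fun e he => ?_
            have he0 : e ≠ 0 := (Nat.pos_of_mem_divisors (Finset.mem_filter.1 he).1).ne'
            exact div_le_div_of_nonneg_right (four_pow_card_primeFactors_le_sigma_zero_sq he0) (Nat.cast_nonneg e)
        _ ≤ ∑ e ∈ Icc 1 ⌊R⌋₊, (σ 0 e : ℝ) ^ 2 / e := by
            refine Finset.sum_le_sum_of_subset_of_nonneg (fun e he => ?_) fun _ _ _ => by positivity
            obtain ⟨he, heR⟩ := Finset.mem_filter.1 he
            exact Finset.mem_Icc.2 ⟨Nat.pos_of_mem_divisors he, Nat.le_floor heR⟩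
        _ ≤ C₂ * Real.log R ^ (2 ^ (2 + 1)) := h2 R hR2
        _ ≤ C₂ * L ^ (8 : ℕ) := by
            refine mul_le_mul_of_nonneg_left ?_ hC₂.le
            rw [show (2 ^ (2 + 1) : ℕ) = 8 by norm_num, hlogR]
            exact pow_le_pow_left₀ (by positivity) (by linarith) 8
    calc ∑ e ∈ P.divisors.filter (fun e : ℕ => (e : ℝ) ≤ R), |J e|
        ≤ ∑ e ∈ P.divisors.filter (fun e : ℕ => (e : ℝ) ≤ R), 2 * Hc * ((4 : ℝ) ^ e.primeFactors.card / e) := by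
          refine Finset.sum_le_sum fun e he => ?_
          obtain ⟨he, heR⟩ := Finset.mem_filter.1 he
          exact hhead e he heR
      _ = 2 * Hc * ∑ e ∈ P.divisors.filter (fun e : ℕ => (e : ℝ) ≤ R), (4 : ℝ) ^ e.primeFactors.card / e := by
          rw [Finset.mul_sum]
      _ ≤ 2 * Hc * (C₂ * L ^ (8 : ℕ)) := mul_le_mul_of_nonneg_left hdiv (by positivity)
      _ = Chead * (4 : ℝ) ^ q.primeFactors.card * Nh / L ^ B := by
          have hL8 : L ^ (B + 8) = L ^ B * L ^ (8 : ℕ) := by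
            rw [← Real.rpow_natCast L 8, ← Real.rpow_add hlogNh0]; norm_num
          have hLB0 : L ^ B ≠ 0 := (Real.rpow_pos_of_pos hlogNh0 B).ne'
          have hL80 : L ^ (8 : ℕ) ≠ 0 := pow_ne_zero 8 hlogNh0.ne'
          rw [hHc, hChead, hL8]
          field_simp
          ring
  -- Step 5: the tail sum (Rankin)
  have hz8 : 8 ≤ ⌈z⌉₊ := by
    have : (8 : ℝ) ≤ ⌈z⌉₊ := le_trans hz (Nat.le_ceil z)
    exact_mod_cast this
  have hceil_le : (⌈z⌉₊ : ℝ) ≤ 2 * z := by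
    have := Nat.ceil_lt_add_one hz0.le; linarith
  set w : ℝ := Real.log (⌈z⌉₊ : ℝ) with hw
  have hwz : Real.log z ≤ w := Real.log_le_log hz0 (Nat.le_ceil z)
  have hw0 : 0 < w := lt_of_lt_of_le hlogz0 hwz
  have hw2K : w ≤ 2 * K * Real.sqrt L := by
    have hlog2' : Real.log 2 ≤ Real.log z := Real.log_le_log (by norm_num) (by linarith)
    calc w ≤ Real.log (2 * z) := Real.log_le_log (by positivity) hceil_le
      _ = Real.log 2 + Real.log z := Real.log_mul two_ne_zero hz0.ne'
      _ ≤ 2 * Real.log z := by linarith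
      _ ≤ 2 * (K * Real.sqrt L) := by linarith
      _ = 2 * K * Real.sqrt L := by ring
  have htailsum : ∑ e ∈ P.divisors.filter (fun e : ℕ => ¬ (e : ℝ) ≤ R), |J e| ≤ Ctail * Nh / L ^ B := by
    -- replace `|J e|` by `3Nh/e` on `e ≤ 2Nh` and by `0` beyond
    have hstep1 : ∑ e ∈ P.divisors.filter (fun e : ℕ => ¬ (e : ℝ) ≤ R), |J e| ≤
        ∑ e ∈ (P.divisors.filter (fun e : ℕ => ¬ (e : ℝ) ≤ R)).filter (fun e : ℕ => (e : ℝ) ≤ 2 * Nh),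
          3 * Nh / e := by
      rw [Finset.sum_filter (p := fun e : ℕ => (e : ℝ) ≤ 2 * Nh)]
      refine Finset.sum_le_sum fun e he => ?_
      obtain ⟨he, heR⟩ := Finset.mem_filter.1 he
      rw [not_le] at heR
      split_ifs with h2
      · exact htail e he heR
      · rw [not_le] at h2
        rw [hJbig e he h2, abs_zero]
    have hsub : (P.divisors.filter (fun e : ℕ => ¬ (e : ℝ) ≤ R)).filter (fun e : ℕ => (e : ℝ) ≤ 2 * Nh) ⊆
        (Nat.smoothNumbersUpTo ⌊2 * Nh⌋₊ ⌈z⌉₊).filter (fun e : ℕ => R < (e : ℝ)) := by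
      intro e he
      simp only [Finset.mem_filter, not_le] at he
      obtain ⟨⟨he, heR⟩, he2⟩ := he
      refine Finset.mem_filter.2 ⟨Nat.mem_smoothNumbersUpTo.2 ⟨Nat.le_floor he2, ?_⟩, heR⟩
      rw [Nat.mem_smoothNumbers']
      intro p hp hpe
      have hpP : p ∣ P := hpe.trans (Nat.dvd_of_mem_divisors he)
      have hpz : (p : ℝ) < z := (dvd_primesProdBelow_iff hp z).1 hpP
      exact Nat.lt_ceil.2 hpz
    have hstep2 : ∑ e ∈ (P.divisors.filter (fun e : ℕ => ¬ (e : ℝ) ≤ R)).filter (fun e : ℕ => (e : ℝ) ≤ 2 * Nh),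
        3 * Nh / e ≤ 3 * Nh * (CR * w ^ 31 * Real.exp (-(Real.log R / w))) := by
      have hrk := sum_inv_smoothNumbersUpTo_tail_le_log ⌊2 * Nh⌋₊ hz8 hR0
      calc ∑ e ∈ (P.divisors.filter (fun e : ℕ => ¬ (e : ℝ) ≤ R)).filter (fun e : ℕ => (e : ℝ) ≤ 2 * Nh), 3 * Nh / e
          = 3 * Nh * ∑ e ∈ (P.divisors.filter (fun e : ℕ => ¬ (e : ℝ) ≤ R)).filter (fun e : ℕ => (e : ℝ) ≤ 2 * Nh),
              ((e : ℝ))⁻¹ := by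
            rw [Finset.mul_sum]; refine Finset.sum_congr rfl fun e _ => ?_; rw [div_eq_mul_inv]
        _ ≤ 3 * Nh * ∑ e ∈ (Nat.smoothNumbersUpTo ⌊2 * Nh⌋₊ ⌈z⌉₊).filter (fun e : ℕ => R < (e : ℝ)), ((e : ℝ))⁻¹ := by
            refine mul_le_mul_of_nonneg_left ?_ (by positivity)
            exact Finset.sum_le_sum_of_subset_of_nonneg hsub fun _ _ _ => by positivity
        _ ≤ 3 * Nh * (CR * w ^ 31 * Real.exp (-(Real.log R / w))) := by
            refine mul_le_mul_of_nonneg_left ?_ (by positivity)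
            simpa only [hCR, hw] using hrk
    -- the saving
    have hexp : Real.exp (-(Real.log R / w)) ≤ Real.exp (-(1 / (4 * K) * Real.sqrt L)) := by
      rw [Real.exp_le_exp, neg_le_neg_iff, hlogR]
      have h1 : L / 2 / (2 * K * Real.sqrt L) ≤ L / 2 / w :=
        div_le_div_of_nonneg_left (by positivity) hw0 hw2K
      refine le_trans (le_of_eq ?_) h1
      field_simp
      nlinarith [hsqL]
    have hwpow : w ^ 31 ≤ (2 * K) ^ (31 : ℕ) * L ^ (31 / 2 : ℝ) := by
      calc w ^ 31 ≤ (2 * K * Real.sqrt L) ^ 31 := pow_le_pow_left₀ hw0.le hw2K 31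
        _ = (2 * K) ^ (31 : ℕ) * (Real.sqrt L) ^ (31 : ℕ) := mul_pow _ _ _
        _ = (2 * K) ^ (31 : ℕ) * L ^ (31 / 2 : ℝ) := by
            congr 1
            rw [Real.sqrt_eq_rpow, ← Real.rpow_natCast, ← Real.rpow_mul hlogNh0.le]
            norm_num
    have hsave : L ^ (31 / 2 : ℝ) * Real.exp (-(1 / (4 * K) * Real.sqrt L)) ≤ C₁ / L ^ (B + 8) := by
      have h1' := h1 L hlogNh1
      rw [le_div_iff₀ (Real.rpow_pos_of_pos hlogNh0 _)]
      calc L ^ (31 / 2 : ℝ) * Real.exp (-(1 / (4 * K) * Real.sqrt L)) * L ^ (B + 8)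
          = (L ^ (31 / 2 : ℝ) * L ^ (B + 8)) * Real.exp (-(1 / (4 * K) * Real.sqrt L)) := by ring
        _ = L ^ (31 / 2 + (B + 8)) * Real.exp (-(1 / (4 * K) * Real.sqrt L)) := by
            rw [← Real.rpow_add hlogNh0]
        _ ≤ C₁ := h1'
    have hLB : (L ^ (B + 8))⁻¹ ≤ (L ^ B)⁻¹ := by
      refine inv_anti₀ (Real.rpow_pos_of_pos hlogNh0 _) ?_
      exact Real.rpow_le_rpow_of_exponent_le hlogNh1 (by linarith)
    calc ∑ e ∈ P.divisors.filter (fun e : ℕ => ¬ (e : ℝ) ≤ R), |J e|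
        ≤ 3 * Nh * (CR * w ^ 31 * Real.exp (-(Real.log R / w))) := hstep1.trans hstep2
      _ ≤ 3 * Nh * (CR * ((2 * K) ^ (31 : ℕ) * L ^ (31 / 2 : ℝ)) * Real.exp (-(1 / (4 * K) * Real.sqrt L))) := by
          refine mul_le_mul_of_nonneg_left ?_ (by positivity)
          exact mul_le_mul (mul_le_mul_of_nonneg_left hwpow hCR0.le) hexp (Real.exp_pos _).le (by positivity)
      _ = 3 * Nh * CR * (2 * K) ^ (31 : ℕ) * (L ^ (31 / 2 : ℝ) * Real.exp (-(1 / (4 * K) * Real.sqrt L))) := by ring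
      _ ≤ 3 * Nh * CR * (2 * K) ^ (31 : ℕ) * (C₁ / L ^ (B + 8)) :=
          mul_le_mul_of_nonneg_left hsave (by positivity)
      _ = Ctail * Nh * (L ^ (B + 8))⁻¹ := by simp only [hCtail]; ring
      _ ≤ Ctail * Nh * (L ^ B)⁻¹ := mul_le_mul_of_nonneg_left hLB (by positivity)
      _ = Ctail * Nh / L ^ B := by rw [div_eq_mul_inv]
  -- Step 6: conclusion
  have hω1 : (1 : ℝ) ≤ (4 : ℝ) ^ q.primeFactors.card := one_le_pow₀ (by norm_num)
  calc |∑ e ∈ P.divisors, J e| ≤ ∑ e ∈ P.divisors, |J e| := Finset.abs_sum_le_sum_abs _ _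
    _ = (∑ e ∈ P.divisors.filter (fun e : ℕ => (e : ℝ) ≤ R), |J e|) +
          ∑ e ∈ P.divisors.filter (fun e : ℕ => ¬ (e : ℝ) ≤ R), |J e| :=
        (Finset.sum_filter_add_sum_filter_not _ _ _).symm
    _ ≤ Chead * (4 : ℝ) ^ q.primeFactors.card * Nh / L ^ B + Ctail * Nh / L ^ B :=
        add_le_add hheadsum htailsum
    _ ≤ Chead * (4 : ℝ) ^ q.primeFactors.card * Nh / L ^ B +
          (Ctail + 1) * (4 : ℝ) ^ q.primeFactors.card * Nh / L ^ B := by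
        refine add_le_add le_rfl (div_le_div_of_nonneg_right ?_ (by positivity))
        refine mul_le_mul_of_nonneg_right ?_ hNh0.le
        calc Ctail = Ctail * 1 := (mul_one _).symm
          _ ≤ (Ctail + 1) * (4 : ℝ) ^ q.primeFactors.card := mul_le_mul (by linarith) hω1 zero_le_one (by positivity)
    _ = (Chead + Ctail + 1) * (4 : ℝ) ^ q.primeFactors.card * Nh / L ^ B := by ring

/-- **`SWAbs` for the sieved, boxed Möbius piece** `μ 1_J 1_{(·,P(z))=1}`, `J = (Y₁, Y₂] ⊆ (Nh, 2Nh]`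
(`Nh ≤ Y₁ ≤ Y₂ ≤ 2Nh`), for sifting levels `z ≥ 8` with `log z ≤ K (log Nh)^{1/2}` and `Nh ≥ e^{16}`:
for every `A₁, A₂ > 0` there is `C` (depending on `K, A₁, A₂` and the Siegel–Walfisz constants only)
with `SWAbs (roughBoxMoebius z Y₁ Y₂) Nh A₁ A₂ C`.  PROVED from the named fact `Literature.NumberTheory.LFunctions.SiegelWalfiszMoebius`
via `abs_sum_roughBoxMoebius_le`. [cite: BombieriFriedlanderIwaniecActa1986, §15 p. 246] -/
theorem swabs_roughBoxMoebius (hSW : LFunctions.SiegelWalfiszMoebius) {K : ℝ} (hK : 1 ≤ K)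
    {A₁ A₂ : ℝ} (hA₁ : 0 < A₁) (hA₂ : 0 < A₂) :
    ∃ C : ℝ, 0 < C ∧ ∀ z Nh : ℝ, ∀ Y₁ Y₂ : ℕ, 8 ≤ z → Real.log z ≤ K * Real.sqrt (Real.log Nh) →
      Real.exp 16 ≤ Nh → Nh ≤ Y₁ → Y₁ ≤ Y₂ → (Y₂ : ℝ) ≤ 2 * Nh →
      SWAbs (roughBoxMoebius z Y₁ Y₂) Nh A₁ A₂ C := by
  obtain ⟨Cμ, hCμ, hcore⟩ := abs_sum_roughBoxMoebius_le hSW hK hA₁ (B := A₂ + 2 * A₁) (by positivity)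
  refine ⟨2 * Cμ, by positivity, ?_⟩
  intro z Nh Y₁ Y₂ hz hlogz hNh hY₁ hY hY₂ k hk hkA l hl d hd y
  haveI : NeZero k := ⟨by omega⟩
  have hNh16 : (16 : ℝ) ≤ Real.log Nh := by
    rw [← Real.log_exp 16]; exact Real.log_le_log (Real.exp_pos _) hNh
  have hNh0 : 0 < Nh := lt_of_lt_of_le (Real.exp_pos 16) hNh
  set L := Real.log Nh with hL
  have hL0 : 0 < L := by linarith
  have hL1 : 1 ≤ L := by linarith
  have hφ1 : (1 : ℝ) ≤ Nat.totient k := by exact_mod_cast Nat.totient_pos.2 hk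
  -- the two sums
  have hT₁ := hcore z Nh Y₁ Y₂ hz hlogz hNh hY₁ hY hY₂ k hk hkA l hl d hd y
  have hone : ((1 : ℕ) : ℝ) ≤ L ^ A₁ := by
    rw [Nat.cast_one]; exact Real.one_le_rpow hL1 hA₁.le
  have hT₂' := hcore z Nh Y₁ Y₂ hz hlogz hNh hY₁ hY hY₂ 1 le_rfl hone (0 : ZMod 1)
    (isUnit_of_subsingleton _) (d * k) (mul_ne_zero hd (by omega)) y
  have hset : (Icc 1 ⌊y⌋₊).filter (fun v : ℕ => v.Coprime (d * k)) =
      (Icc 1 ⌊y⌋₊).filter (fun v : ℕ => (v : ZMod 1) = 0 ∧ v.Coprime (d * k)) := by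
    refine Finset.filter_congr fun v _ => ?_
    constructor
    · intro h; exact ⟨Subsingleton.elim _ _, h⟩
    · intro h; exact h.2
  have hT₂ : |∑ v ∈ (Icc 1 ⌊y⌋₊).filter (fun v : ℕ => v.Coprime (d * k)), roughBoxMoebius z Y₁ Y₂ v| ≤
      Cμ * (4 : ℝ) ^ (d * k).primeFactors.card * Nh / L ^ (A₂ + 2 * A₁) := by
    rw [hset]; exact hT₂'
  -- `4^{ω(d)}, 4^{ω(dk)} ≤ τ(d)² k² ≤ τ(d)² L^{2A₁}`
  have hτd : (4 : ℝ) ^ d.primeFactors.card ≤ (σ 0 d : ℝ) ^ 2 := four_pow_card_primeFactors_le_sigma_zero_sq hd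
  have hτd1 : (1 : ℝ) ≤ (σ 0 d : ℝ) ^ 2 := le_trans (one_le_pow₀ (by norm_num)) hτd
  have hk2 : (4 : ℝ) ^ k.primeFactors.card ≤ L ^ (2 * A₁) := by
    calc (4 : ℝ) ^ k.primeFactors.card ≤ (σ 0 k : ℝ) ^ 2 := four_pow_card_primeFactors_le_sigma_zero_sq (by omega)
      _ ≤ (k : ℝ) ^ 2 := pow_le_pow_left₀ (Nat.cast_nonneg _) (sigma_zero_le_self_real k) 2
      _ ≤ (L ^ A₁) ^ 2 := pow_le_pow_left₀ (Nat.cast_nonneg _) hkA 2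
      _ = L ^ (2 * A₁) := by rw [← Real.rpow_natCast, ← Real.rpow_mul hL0.le]; ring_nf
  have hL2A : (1 : ℝ) ≤ L ^ (2 * A₁) := Real.one_le_rpow hL1 (by positivity)
  have hτdk : (4 : ℝ) ^ (d * k).primeFactors.card ≤ (σ 0 d : ℝ) ^ 2 * L ^ (2 * A₁) :=
    (four_pow_card_primeFactors_mul_le d k).trans (mul_le_mul hτd hk2 (by positivity) (by positivity))
  have hsplit : L ^ (A₂ + 2 * A₁) = L ^ A₂ * L ^ (2 * A₁) := Real.rpow_add hL0 _ _
  -- combine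
  have hφ : (0 : ℝ) < Nat.totient k := by linarith
  calc _ ≤ |∑ v ∈ (Icc 1 ⌊y⌋₊).filter (fun v : ℕ => (v : ZMod k) = l ∧ v.Coprime d), roughBoxMoebius z Y₁ Y₂ v| +
        |(∑ v ∈ (Icc 1 ⌊y⌋₊).filter (fun v : ℕ => v.Coprime (d * k)), roughBoxMoebius z Y₁ Y₂ v) /
          (Nat.totient k : ℝ)| := abs_sub _ _
    _ ≤ Cμ * (4 : ℝ) ^ d.primeFactors.card * Nh / L ^ (A₂ + 2 * A₁) +
        Cμ * (4 : ℝ) ^ (d * k).primeFactors.card * Nh / L ^ (A₂ + 2 * A₁) := by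
        refine add_le_add hT₁ ?_
        rw [abs_div, abs_of_pos hφ]
        exact (div_le_self (abs_nonneg _) hφ1).trans hT₂
    _ ≤ Cμ * ((σ 0 d : ℝ) ^ 2 * L ^ (2 * A₁)) * Nh / L ^ (A₂ + 2 * A₁) +
        Cμ * ((σ 0 d : ℝ) ^ 2 * L ^ (2 * A₁)) * Nh / L ^ (A₂ + 2 * A₁) := by
        have h1 : (4 : ℝ) ^ d.primeFactors.card ≤ (σ 0 d : ℝ) ^ 2 * L ^ (2 * A₁) :=
          hτd.trans (le_mul_of_one_le_right (by positivity) hL2A)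
        gcongr
    _ = 2 * Cμ * (σ 0 d : ℝ) ^ 2 * Nh / L ^ A₂ := by
        rw [hsplit]
        have : L ^ (2 * A₁) ≠ 0 := (Real.rpow_pos_of_pos hL0 _).ne'
        field_simp
        ring

end BFI

end Literature.NumberTheory.Sieve
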